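import Summits.AnomalousDissipation.AnomalousDissipation.Theorems.SolenoidalFractalHomogenisationLagrangianStepSidebandXEnergyDecay
import Summits.AnomalousDissipation.AnomalousDissipation.Theorems.SolenoidalFractalHomogenisationLagrangianStepSidebandXEnergyConstDefs
import HarnessLib

/-!
# K1L_D `LagrangianRenormalisationStepDesign` (stmt-AnomalousDissipation-27980), `stub_D1_V0R` (ruling D27-1), brick T8b-1: THE RESIDUAL ENERGY INEQUALITY WITH ITS
# EXPLICIT CONSTANT, an abstract right-Grönwall from `0` for an interior differential inequality, and the DECAY OF THE RESIDUAL WITH THE BOX VECTOR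
# ELIMINATED (`‖Z‖ ≤ ‖r‖ + ‖y‖`, half the dissipation rate) (helper; `--kind proof --supports stmt-AnomalousDissipation-27980 --as helper`)

Summits-side helper file of route `SolenoidalFractalHomogenisation` (prover seat `ad-k1l-cellLawV-w1` g7; 0 sorry, no defs, no named facts).  The assembly of
`stub_D1_V0R` must see the `ν`-dependence of the constant of `…SidebandXEnergy.residualX_energy_ineq` (hidden by its `∃ C`) and must not carry the crude
term `ξ⁴‖Z‖²` (with `‖Z‖ ≤ √E` it costs a factor `ν/ξ` too much; cell STATUS 2026-08-29 w1 g7 sizing): here the constant is `energyConst W₁ lo hi β`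
(`…SidebandXEnergyConstDefs`, the proof's constant verbatim) and `Z = r + projX y` is folded into the dissipation (`2Cξ⁴ ≤ π²lo/4`) and the reference state.
* **`residualX_energy_ineq_explicit`** — `φ ≤ −(π²lo/2)‖r‖² + energyConst·(ξ²‖y‖² + ξ⁴‖x‖² + ξ⁴‖Z‖² + tailEnergy)`;
* `le_exp_integral_of_deriv_right_le_Ioo` — abstract: `Φ, g` continuous on `[0,T]`, right derivative `≤ −σΦ + g` on `(0,T)` ⇒
  `Φ t ≤ e^{−σt}Φ 0 + ∫₀ᵗ e^{−σ(t−s)} g` on `[0,T]` (`…RightGronwall` on `[a,T]`, `a → 0⁺`);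
* **`residualX_norm_sq_le_elim`** — with `‖x s‖ ≤ M` on `[0,T]` and `energyConst·ξ⁴ ≤ π²lo/8`:
  `‖r t‖² ≤ e^{−(π²lo/4)t}‖r 0‖² + ∫₀ᵗ e^{−(π²lo/4)(t−s)}(energyConst·(ξ⁴(xiCN²(1+2ξ²)+1))·M² + energyConst·tailEnergy s) ds`.
NOT a proof of any registered stub, of K1L_D, or of anomalous dissipation; rung F-D1.A0 infrastructure.
-/

set_option linter.dupNamespace false

noncomputable section

namespace Summit.AnomalousDissipation.AnomalousDissipation.Theorems.SolenoidalFractalHomogenisation.LagrangianStep.Sideband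

open Set MeasureTheory Complex UnitAddTorus Filter Topology intervalIntegral
open scoped InnerProductSpace
open Literature.Analysis Literature.Analysis.FunctionSpaces Literature.Analysis.FunctionSpaces.Torus
open Literature.Analysis.FluidPDE Literature.Analysis.FluidPDE.Torus Literature.Analysis.FluidPDE.LatticeShear
open Summit.AnomalousDissipation.AnomalousDissipation.Theorems.SolenoidalFractalHomogenisation.LagrangianStep.CellChain
  (modeRep kdot_modeRep continuousOn_modeRep norm_transversalProj_le)
open Summit.AnomalousDissipation.AnomalousDissipation.Theorems.SolenoidalFractalHomogenisation.LagrangianStep.RightGronwall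
  (le_exp_of_deriv_right_le)

variable {k₀ : ℕ}

/-! ## §1 The energy inequality with the explicit constant -/

/-- **THE ENERGY INEQUALITY OF THE RESIDUAL, EXPLICIT CONSTANT** (same proof as `residualX_energy_ineq`).
[cite: MajdaKramer1999, §2.2.1.3 (cell problem (49))] [cite: SandersVerhulstMurdock2007, Lemma 5.2.7 (linear case)] -/
theorem residualX_energy_ineq_explicit (W₁ : LatticeWord k₀) {lo hi β : ℝ} (hlo : 0 < lo) (hhi : 0 ≤ hi) (hβ : 0 ≤ β)
    {n : ℕ} (hn : n ≠ 0) {𝔸 : Torus.Visc4 (Fin 3)} (h𝔸 : Torus.NearIso 𝔸 lo hi) (hodd : Torus.OddSmall 𝔸 β)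
    {T : ℝ} {F : UnitAddTorus (Fin 3) → EuclideanSpace ℝ (Fin 3)} {w : ℝ → UnitAddTorus (Fin 3) → EuclideanSpace ℝ (Fin 3)}
    (h : Torus.IsWeakTensorPassiveVectorOn 0 T ((1 / (n : ℝ) ^ 2) • 𝔸) (W₁.cell n) F w) (hF : Integrable F volume)
    {ℓ : Fin 3 → ℤ} (hℓ : 2 * Real.sqrt (freqNormSq ℓ) ≤ n) {R : ℕ} (hbox : ∀ j, (W₁.phase j).m ∈ box R) {t : ℝ} (ht : t ∈ Ioo 0 T) :
    ∃ φ : ℝ, HasDerivWithinAt (fun τ => ‖residualX W₁ n ℓ 𝔸 R F w τ‖ ^ 2) φ (Ici t) t ∧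
      φ ≤ -(Real.pi ^ 2 * lo / 2) * ‖residualX W₁ n ℓ 𝔸 R F w t‖ ^ 2 +
        energyConst W₁ lo hi β * ((Real.sqrt (freqNormSq ℓ) / n) ^ 2 * ‖refState W₁ n ℓ 𝔸 R F w t‖ ^ 2 +
          (Real.sqrt (freqNormSq ℓ) / n) ^ 4 * ‖modeRep W₁ n ((1 / (n : ℝ) ^ 2) • 𝔸) F w ℓ t‖ ^ 2 +
          (Real.sqrt (freqNormSq ℓ) / n) ^ 4 * ‖sbVec W₁ n ((1 / (n : ℝ) ^ 2) • 𝔸) F w ℓ R t‖ ^ 2 +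
          tailEnergy W₁ n ℓ 𝔸 R F w t) := by
  have hCN0 : 0 ≤ xiCN W₁ lo := xiCN_nonneg W₁ hlo
  have hT : 0 < T := ht.1.trans ht.2
  have htI : t ∈ Icc 0 T := ⟨ht.1.le, ht.2.le⟩
  have hn0 : (0 : ℝ) < n := by exact_mod_cast Nat.pos_of_ne_zero hn
  have hξ0 : 0 ≤ Real.sqrt (freqNormSq ℓ) / n := by positivity
  have hξ1 : Real.sqrt (freqNormSq ℓ) / n ≤ 1 := by
    rw [div_le_one hn0]; linarith [Real.sqrt_nonneg (freqNormSq ℓ)]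
  have h𝔹 : Torus.NearIso ((1 / (n : ℝ) ^ 2) • 𝔸) (1 / (n : ℝ) ^ 2 * lo) (1 / (n : ℝ) ^ 2 * hi) := h𝔸.smul (by positivity)
  have hN : ∀ j, IsPeriodicResponse W₁ 𝔸 1 R j (response W₁ 𝔸 1 R j) := fun j => isPeriodicResponse_response_of_nearIso W₁ h𝔸 hlo one_pos R j
  have hder := hasDerivWithinAt_residual W₁ n h hF ℓ 1 hbox ht (s := Ici t)
    (fun j => hasDerivWithinAt_responseExt W₁ 𝔸 1 R j (hN j) t)
  rw [← residualX_eq, ← residualX_apply_expanded, ← refState_def] at hder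
  refine ⟨_, hasDerivWithinAt_norm_sq_of_genX W₁ n ℓ ((1 / (n : ℝ) ^ 2) • 𝔸) 1 hder, ?_⟩
  have hrT : ∀ z : box R, transversalProj (classFreq n ℓ z.1) (residualX W₁ n ℓ 𝔸 R F w t z) = residualX W₁ n ℓ 𝔸 R F w t z :=
    fun z => residual_transversal W₁ n hT.le h ℓ R htI _ z
  have hyT : ∀ z : box R, transversalProj z.1 (refState W₁ n ℓ 𝔸 R F w t z) = refState W₁ n ℓ 𝔸 R F w t z :=
    fun z => transversalProj_refState_apply W₁ ℓ h𝔸 hlo R F w t z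
  have hxT : kdot ℓ (modeRep W₁ n ((1 / (n : ℝ) ^ 2) • 𝔸) F w ℓ t) = 0 := kdot_modeRep W₁ n hT.le h ℓ htI
  have hA := two_inner_genX_add_le W₁ n ℓ h𝔹 1 t hrT
  have hC := two_real_inner_D1_le W₁ h𝔸 hlo hhi hodd hβ hn hℓ (R := R) 1 1 t hrT hyT
  have hD := sum_two_abs_re_inner_tail_le W₁ hn hℓ hlo 𝔸 R F w t (residualX W₁ n ℓ 𝔸 R F w t)
  have hS := norm_sq_le_dissipation hℓ (residualX W₁ n ℓ 𝔸 R F w t)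
  have hd₂b := norm_sum_smul_sourceX_sub_le W₁ hn ℓ R t (modeRep W₁ n ((1 / (n : ℝ) ^ 2) • 𝔸) F w ℓ t)
  have hXd := norm_slowRHS_le_xi W₁ hn ℓ h𝔸 hlo hhi hodd hβ t hxT (sbVec W₁ n ((1 / (n : ℝ) ^ 2) • 𝔸) F w ℓ R t)
  have hmain := defect_bookkeeping hn hlo hhi hβ (tailEnergy_nonneg W₁ n ℓ 𝔸 R F w t) hξ0 hξ1 hCN0 (hA _)
    (two_real_inner_defect_split _ _ _ _ _) hC hD hS (norm_nonneg _) (norm_nonneg _) hd₂b hXd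
    (norm_projX_sum_smul_responseExt_le W₁ n ℓ h𝔸 hlo R t _)
  unfold energyConst xiCf
  rw [xiCN_def]
  exact hmain

/-! ## §2 Abstract right-Grönwall from `0` for an interior differential inequality -/

/-- **Right-Grönwall from `0`, interior version**: `Φ, g` continuous on `[0,T]`, and at every `t ∈ (0,T)` a right derivative `φ` of `Φ` with
`φ ≤ −σΦ t + g t` ⇒ `Φ t ≤ e^{−σt}Φ 0 + ∫₀ᵗ e^{−σ(t−s)} g s ds` on `[0,T]`. [cite: BedrossianCotiZelati2017, §2] -/
theorem le_exp_integral_of_deriv_right_le_Ioo {Φ g : ℝ → ℝ} {T σ : ℝ} (hΦc : ContinuousOn Φ (Icc 0 T)) (hgc : ContinuousOn g (Icc 0 T))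
    (hd : ∀ t ∈ Ioo 0 T, ∃ φ : ℝ, HasDerivWithinAt Φ φ (Ici t) t ∧ φ ≤ -σ * Φ t + g t) {t : ℝ} (ht : t ∈ Icc 0 T) :
    Φ t ≤ Real.exp (-(σ * t)) * Φ 0 + ∫ s in (0:ℝ)..t, Real.exp (-(σ * (t - s))) * g s := by
  rcases ht.1.eq_or_lt with h0 | htpos
  · rw [← h0, intervalIntegral.integral_same, mul_zero, neg_zero, Real.exp_zero, one_mul, add_zero]
  have hT : 0 < T := htpos.trans_le ht.2
  choose! φ hφ using hd
  -- on `[a,T]`, `a > 0`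
  have hest0 : ∀ a ∈ Ioo 0 t, Φ t ≤ Real.exp (-(σ * (t - a))) * Φ a + ∫ s in a..t, Real.exp (-(σ * (t - s))) * g s := by
    intro a ha
    have hsub : Icc a T ⊆ Icc 0 T := Icc_subset_Icc_left ha.1.le
    exact le_exp_of_deriv_right_le (hΦc.mono hsub) (fun s hs => (hφ s ⟨ha.1.trans_le hs.1, hs.2⟩).1) (hgc.mono hsub)
      (fun s hs => (hφ s ⟨ha.1.trans_le hs.1, hs.2⟩).2) t ⟨ha.2.le, ht.2⟩
  set G : ℝ → ℝ := fun s => Real.exp (-(σ * (t - s))) * g s with hG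
  have hGc : ContinuousOn G (Icc 0 T) := (Continuous.continuousOn (by fun_prop)).mul hgc
  have hGi : IntegrableOn G (uIcc 0 T) volume := by rw [uIcc_of_le hT.le]; exact hGc.integrableOn_Icc
  have hGint : ∀ {c : ℝ}, c ∈ Icc 0 T → IntervalIntegrable G volume 0 c := fun {c} hc =>
    (hGc.mono (by rw [uIcc_of_le hc.1]; exact Icc_subset_Icc_right hc.2)).intervalIntegrable
  have hest : ∀ a ∈ Ioo 0 t, Φ t ≤ Real.exp (-(σ * (t - a))) * Φ a + ((∫ s in (0:ℝ)..t, G s) - ∫ s in (0:ℝ)..a, G s) := by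
    intro a ha
    rw [intervalIntegral.integral_interval_sub_left (hGint ht) (hGint ⟨ha.1.le, (ha.2.trans_le ht.2).le⟩)]
    exact hest0 a ha
  have hle : 𝓝[>] (0:ℝ) ≤ 𝓝[Icc 0 T] 0 := nhdsWithin_le_of_mem (Icc_mem_nhdsGT hT)
  have hΦ0 : Tendsto Φ (𝓝[>] 0) (𝓝 (Φ 0)) := ((hΦc 0 ⟨le_rfl, hT.le⟩).tendsto).mono_left hle
  have hexp0 : Tendsto (fun a => Real.exp (-(σ * (t - a)))) (𝓝[>] 0) (𝓝 (Real.exp (-(σ * (t - 0))))) :=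
    ((by fun_prop : Continuous fun a => Real.exp (-(σ * (t - a)))).tendsto 0).mono_left nhdsWithin_le_nhds
  have hP0 : Tendsto (fun a => ∫ s in (0:ℝ)..a, G s) (𝓝[>] 0) (𝓝 (∫ s in (0:ℝ)..0, G s)) := by
    have hc := intervalIntegral.continuousOn_primitive_interval (μ := volume) hGi
    rw [uIcc_of_le hT.le] at hc
    exact ((hc 0 ⟨le_rfl, hT.le⟩).tendsto).mono_left hle
  have hlim : Tendsto (fun a => Real.exp (-(σ * (t - a))) * Φ a + ((∫ s in (0:ℝ)..t, G s) - ∫ s in (0:ℝ)..a, G s))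
      (𝓝[>] 0) (𝓝 (Real.exp (-(σ * (t - 0))) * Φ 0 + ((∫ s in (0:ℝ)..t, G s) - ∫ s in (0:ℝ)..0, G s))) :=
    (hexp0.mul hΦ0).add (tendsto_const_nhds.sub hP0)
  have hev : ∀ᶠ a in 𝓝[>] (0:ℝ), Φ t ≤ Real.exp (-(σ * (t - a))) * Φ a + ((∫ s in (0:ℝ)..t, G s) - ∫ s in (0:ℝ)..a, G s) :=
    Filter.mem_of_superset (Ioo_mem_nhdsGT htpos) fun a ha => hest a ha
  have hfin := ge_of_tendsto hlim hev
  rw [sub_zero, intervalIntegral.integral_same, sub_zero] at hfin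
  exact hfin

/-! ## §3 Decay of the residual with the box vector eliminated -/

/-- Scalar step: `Zn ≤ N + Y`, `Y ≤ ξ·CN·X`, `X ≤ M`, `2Cξ⁴ ≤ σ₀/2` turn the explicit energy inequality into
`φ ≤ −(σ₀/2)N² + (C(ξ⁴(CN²(1+2ξ²)+1))M² + Cτ)`. [folklore] -/
theorem elim_box_bookkeeping {φ N Y X Zn τ ξ σ₀ C CN M : ℝ} (hC : 0 ≤ C) (hN : 0 ≤ N) (hY : 0 ≤ Y)
    (hX : 0 ≤ X) (hZn : Zn ≤ N + Y) (hZ0 : 0 ≤ Zn) (hYX : Y ≤ ξ * CN * X) (hXM : X ≤ M) (hsmall : C * ξ ^ 4 ≤ σ₀ / 4)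
    (hφ : φ ≤ -σ₀ * N ^ 2 + C * (ξ ^ 2 * Y ^ 2 + ξ ^ 4 * X ^ 2 + ξ ^ 4 * Zn ^ 2 + τ)) :
    φ ≤ -(σ₀ / 2) * N ^ 2 + (C * (ξ ^ 4 * (CN ^ 2 * (1 + 2 * ξ ^ 2) + 1)) * M ^ 2 + C * τ) := by
  have hZ2 : Zn ^ 2 ≤ 2 * N ^ 2 + 2 * Y ^ 2 := by nlinarith [sq_nonneg (N - Y)]
  have hY2 : Y ^ 2 ≤ ξ ^ 2 * CN ^ 2 * X ^ 2 := by
    calc Y ^ 2 ≤ (ξ * CN * X) ^ 2 := pow_le_pow_left₀ hY hYX 2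
      _ = ξ ^ 2 * CN ^ 2 * X ^ 2 := by ring
  have hX2 : X ^ 2 ≤ M ^ 2 := pow_le_pow_left₀ hX hXM 2
  have hξ2 : 0 ≤ ξ ^ 2 := sq_nonneg _
  have hξ4 : 0 ≤ ξ ^ 4 := by positivity
  -- the `Y`-terms and the `X`-term against `M²`
  have h1 : C * (ξ ^ 2 * Y ^ 2) ≤ C * (ξ ^ 4 * CN ^ 2 * M ^ 2) := by
    refine mul_le_mul_of_nonneg_left ?_ hC
    calc ξ ^ 2 * Y ^ 2 ≤ ξ ^ 2 * (ξ ^ 2 * CN ^ 2 * X ^ 2) := mul_le_mul_of_nonneg_left hY2 hξ2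
      _ ≤ ξ ^ 2 * (ξ ^ 2 * CN ^ 2 * M ^ 2) := mul_le_mul_of_nonneg_left (mul_le_mul_of_nonneg_left hX2 (by positivity)) hξ2
      _ = ξ ^ 4 * CN ^ 2 * M ^ 2 := by ring
  have h2 : C * (ξ ^ 4 * X ^ 2) ≤ C * (ξ ^ 4 * M ^ 2) := mul_le_mul_of_nonneg_left (mul_le_mul_of_nonneg_left hX2 hξ4) hC
  have h3 : C * (ξ ^ 4 * (2 * Y ^ 2)) ≤ C * (2 * ξ ^ 6 * CN ^ 2 * M ^ 2) := by
    refine mul_le_mul_of_nonneg_left ?_ hC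
    calc ξ ^ 4 * (2 * Y ^ 2) ≤ ξ ^ 4 * (2 * (ξ ^ 2 * CN ^ 2 * M ^ 2)) := by
          refine mul_le_mul_of_nonneg_left ?_ hξ4
          nlinarith [mul_le_mul_of_nonneg_left hX2 (show 0 ≤ ξ ^ 2 * CN ^ 2 by positivity)]
      _ = 2 * ξ ^ 6 * CN ^ 2 * M ^ 2 := by ring
  have h4 : C * (ξ ^ 4 * (2 * N ^ 2)) ≤ σ₀ / 2 * N ^ 2 := by nlinarith [hsmall, sq_nonneg N]
  have hsplit : C * (ξ ^ 2 * Y ^ 2 + ξ ^ 4 * X ^ 2 + ξ ^ 4 * Zn ^ 2 + τ) ≤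
      C * (ξ ^ 2 * Y ^ 2) + C * (ξ ^ 4 * X ^ 2) + C * (ξ ^ 4 * (2 * N ^ 2)) + C * (ξ ^ 4 * (2 * Y ^ 2)) + C * τ := by
    have : C * (ξ ^ 4 * Zn ^ 2) ≤ C * (ξ ^ 4 * (2 * N ^ 2)) + C * (ξ ^ 4 * (2 * Y ^ 2)) := by
      rw [← mul_add, ← mul_add]; exact mul_le_mul_of_nonneg_left (mul_le_mul_of_nonneg_left hZ2 hξ4) hC
    nlinarith [this]
  have e : C * (ξ ^ 4 * (CN ^ 2 * (1 + 2 * ξ ^ 2) + 1)) * M ^ 2 =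
      C * (ξ ^ 4 * CN ^ 2 * M ^ 2) + C * (ξ ^ 4 * M ^ 2) + C * (2 * ξ ^ 6 * CN ^ 2 * M ^ 2) := by ring
  rw [e]
  linarith [hφ, hsplit, h1, h2, h3, h4]

/-- **DECAY OF THE RESIDUAL, BOX VECTOR ELIMINATED, EXPLICIT CONSTANTS (T4d′)**: with `C := energyConst W₁ lo hi β`, an a priori bound `‖x s‖ ≤ M` on
`[0,T]` and the smallness `C·ξ⁴ ≤ π²lo/8`, for every `t ∈ [0,T]`:
`‖r t‖² ≤ e^{−(π²lo/4)t}‖r 0‖² + ∫₀ᵗ e^{−(π²lo/4)(t−s)}·(C(ξ⁴(xiCN²(1+2ξ²)+1))M² + C·tailEnergy s) ds`.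
[cite: BedrossianCotiZelati2017, §2] [cite: MajdaKramer1999, §2.2.1.3 (cell problem (49))] -/
theorem residualX_norm_sq_le_elim (W₁ : LatticeWord k₀) {lo hi β : ℝ} (hlo : 0 < lo) (hhi : 0 ≤ hi) (hβ : 0 ≤ β)
    {n : ℕ} (hn : n ≠ 0) {𝔸 : Torus.Visc4 (Fin 3)} (h𝔸 : Torus.NearIso 𝔸 lo hi) (hodd : Torus.OddSmall 𝔸 β)
    {T : ℝ} {F : UnitAddTorus (Fin 3) → EuclideanSpace ℝ (Fin 3)} {w : ℝ → UnitAddTorus (Fin 3) → EuclideanSpace ℝ (Fin 3)}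
    (h : Torus.IsWeakTensorPassiveVectorOn 0 T ((1 / (n : ℝ) ^ 2) • 𝔸) (W₁.cell n) F w) (hF : Integrable F volume)
    {ℓ : Fin 3 → ℤ} (hℓ : 2 * Real.sqrt (freqNormSq ℓ) ≤ n) {R : ℕ} (hbox : ∀ j, (W₁.phase j).m ∈ box R) {M : ℝ}
    (hM : ∀ s ∈ Icc 0 T, ‖modeRep W₁ n ((1 / (n : ℝ) ^ 2) • 𝔸) F w ℓ s‖ ≤ M)
    (hsmall : energyConst W₁ lo hi β * (Real.sqrt (freqNormSq ℓ) / n) ^ 4 ≤ Real.pi ^ 2 * lo / 8) {t : ℝ} (ht : t ∈ Icc 0 T) :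
    ‖residualX W₁ n ℓ 𝔸 R F w t‖ ^ 2 ≤
      Real.exp (-(Real.pi ^ 2 * lo / 4 * t)) * ‖residualX W₁ n ℓ 𝔸 R F w 0‖ ^ 2 +
        ∫ s in (0:ℝ)..t, Real.exp (-(Real.pi ^ 2 * lo / 4 * (t - s))) *
          (energyConst W₁ lo hi β * ((Real.sqrt (freqNormSq ℓ) / n) ^ 4 * (xiCN W₁ lo ^ 2 * (1 + 2 * (Real.sqrt (freqNormSq ℓ) / n) ^ 2) + 1)) * M ^ 2 +
            energyConst W₁ lo hi β * tailEnergy W₁ n ℓ 𝔸 R F w s) := by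
  rcases le_or_gt T 0 with hT0 | hT
  · -- degenerate horizon: `t = 0`
    have ht0 : t = 0 := le_antisymm (ht.2.trans hT0) ht.1
    rw [ht0, intervalIntegral.integral_same, mul_zero, neg_zero, Real.exp_zero, one_mul, add_zero]
  have hC0 := energyConst_nonneg W₁ hlo hi β
  refine le_exp_integral_of_deriv_right_le_Ioo (σ := Real.pi ^ 2 * lo / 4)
    ((((continuousOn_residualX W₁ ℓ h𝔸 hlo R hT.le h)).norm).pow 2)
    (continuousOn_const.add (continuousOn_const.mul (continuousOn_tailEnergy W₁ n ℓ 𝔸 R hT.le h))) (fun s hs => ?_) ht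
  obtain ⟨φ, hφd, hφ⟩ := residualX_energy_ineq_explicit W₁ hlo hhi hβ hn h𝔸 hodd h hF hℓ hbox hs
  refine ⟨φ, hφd, ?_⟩
  have hsI : s ∈ Icc 0 T := ⟨hs.1.le, hs.2.le⟩
  -- the sizes at time `s`
  have hZn : ‖sbVec W₁ n ((1 / (n : ℝ) ^ 2) • 𝔸) F w ℓ R s‖ ≤ ‖residualX W₁ n ℓ 𝔸 R F w s‖ + ‖refState W₁ n ℓ 𝔸 R F w s‖ := by
    have e : sbVec W₁ n ((1 / (n : ℝ) ^ 2) • 𝔸) F w ℓ R s = residualX W₁ n ℓ 𝔸 R F w s + projX n ℓ R (refState W₁ n ℓ 𝔸 R F w s) := by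
      rw [residualX_apply, sub_add_cancel]
    rw [e]
    exact (norm_add_le _ _).trans (add_le_add le_rfl (norm_projX_le n ℓ _))
  have hYX := norm_refState_le W₁ n ℓ h𝔸 hlo R F w s
  rw [← xiCN_def] at hYX
  have hsmall' : energyConst W₁ lo hi β * (Real.sqrt (freqNormSq ℓ) / n) ^ 4 ≤ Real.pi ^ 2 * lo / 2 / 4 := by linarith
  have hmain := elim_box_bookkeeping (σ₀ := Real.pi ^ 2 * lo / 2) hC0 (norm_nonneg _) (norm_nonneg _) (norm_nonneg _) hZn (norm_nonneg _)
    hYX (hM s hsI) hsmall' hφ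
  have e2 : -(Real.pi ^ 2 * lo / 2 / 2) * ‖residualX W₁ n ℓ 𝔸 R F w s‖ ^ 2 = -(Real.pi ^ 2 * lo / 4) * ‖residualX W₁ n ℓ 𝔸 R F w s‖ ^ 2 := by
    ring
  rw [e2] at hmain
  exact hmain

end Summit.AnomalousDissipation.AnomalousDissipation.Theorems.SolenoidalFractalHomogenisation.LagrangianStep.Sideband

end
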